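import Literature.AlgebraicGeometry.Motives.AbelianVarietyConjugateTransport
import Literature.AlgebraicGeometry.Motives.TateAbelianFiniteSteps
import Literature.NumberTheory.GaloisRepresentations.AbsGaloisConjBy
import Mathlib.LinearAlgebra.Dual.Lemmas
import HarnessLib

/-!
# The `σ̃`-transport on `V_ℓ` and on `H¹_ét = (V_ℓ)^∨`: `H¹_ét(A₀^γ) ≃ H¹_ét(A₀)` carries the Galois action at `τ`
# to the action at `σ̃⁻¹τσ̃` (Shimura 1998, §18.6; Deligne 1982, §1)

Topic `Literature/AlgebraicGeometry/Motives`, namespace `Literature.AlgebraicGeometry.Motives.AbelianVariety`.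
DEFINITIONS WITH BODIES and THEOREMS, all proved; no named fact, no instance, no notation (net Literature debt 0).
Sequel of ★ `AbelianVarietyConjugateTransport` (the `σ̃`-transport `E : T_ℓ(A₀) ≃ₗ[ℤ_ℓ] T_ℓ(A₀^γ)` of §3 there, with its
TWISTED Galois equivariance `E (ρ • a) = τ • E a` for `σ̃ρ = τσ̃` and its naturality in `f : A₀ → B₀`), read on the
RATIONAL Tate module `V_ℓ = ℚ_ℓ ⊗_{ℤ_ℓ} T_ℓ` and on its `ℚ_ℓ`-dual — the degree-one étale cohomology
`H¹_ét(A ⊗ K̄, ℚ_ℓ) = Hom(V_ℓ A, ℚ_ℓ)` (Milne, *Abelian varieties*, Thm. 15.1 (a); the currency of the cell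
`hodgecm-mathlib`'s `Liu2021/AppendixC/EtaleH1Tower`: `etaleH1Rep = (rationalTateRep).dual`).

For `γ : K ≃+* K`, `σ̃ : K̄ ≃+* K̄` lifting `γ` (`hσa`), `f := absGalConjBy σ̃ γ hσa : Γ_K →* Γ_K`, `τ ↦ σ̃⁻¹τσ̃`
(★ `GaloisRepresentations/AbsGaloisConjBy`), an abelian variety `A₀` over `K` and a prime `ℓ`:
* §1 `conjTransportRatTateEquiv γ σ̃ hσa A₀ ℓ : V_ℓ(A₀) ≃ₗ[ℚ_ℓ] V_ℓ(A₀^γ)` (base change of `E`), with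
  `conjTransportRatTateEquiv_rationalTateRep : Eℚ (ρ_{A₀}(f τ) v) = ρ_{A₀^γ}(τ) (Eℚ v)` and naturality
  `Eℚ_B ∘ V_ℓ(f) = V_ℓ(f^γ) ∘ Eℚ_A`;
* §2 **`conjTransportEtaleH1Equiv γ σ̃ hσa A₀ ℓ : Module.Dual ℚ_ℓ (V_ℓ(A₀^γ)) ≃ₗ[ℚ_ℓ] Module.Dual ℚ_ℓ (V_ℓ A₀)`** (the dual
  of `Eℚ`), with the CONTRAGREDIENT equivariance
  **`conjTransportEtaleH1Equiv_dual : ψ ((ρ_{A₀^γ}).dual τ φ) = (ρ_{A₀}).dual (f τ) (ψ φ)`** — «an arithmetic Frobenius at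
  `𝔓` on `H¹(A₀^γ)` is read on `H¹(A₀)` as `σ̃⁻¹ Frob_𝔓 σ̃`, a Frobenius at `σ̃⁻¹𝔓`» — and naturality
  `ψ_A ∘ (V_ℓ(f^γ))^∨ = (V_ℓ f)^∨ ∘ ψ_B`.

Written for the cell `hodgecm-mathlib` (D-0151) as the abelian-variety half of the «K2 transport lemma» (director s201 (3)(ii),
2026-08-30): the c-twist `X_K = M_K ⊗_{F,c} F` of a canonical model has `H¹_ét` equal to that of `M_K` with the Galois
action conjugated by a lift `c̃` of `c`.

References: [Shimura1998] G. Shimura, *Abelian Varieties with Complex Multiplication and Modular Functions* (1998), §18.6,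
proof of Thm. 18.6, p. 129 («`x ↦ x^σ`», `σ` on `A[ℓ^m]`); [Deligne1982] P. Deligne, *Hodge cycles on abelian varieties*,
§1 (the conjugate variety `σX`); [Milne1986AbelianVarieties] J. S. Milne, *Abelian varieties*, Thm. 15.1 (a)
(`H¹(A_et, ℤ_ℓ) = Hom(T_ℓ A, ℤ_ℓ)`); [SerreTate1968] §1 (`T_ℓ`, `V_ℓ` as Galois modules).
-/

noncomputable section

open scoped TensorProduct
open CategoryTheory
open Literature.NumberTheory.GaloisRepresentations (absGalConjBy apply_absGalConjBy_smul)

namespace Literature.AlgebraicGeometry.Motives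

namespace AbelianVariety

section RatTate

variable {K : Type} [Field K] (γ : K ≃+* K) (σt : AlgebraicClosure K ≃+* AlgebraicClosure K)
  (hσa : ∀ a : K, σt (algebraMap K (AlgebraicClosure K) a) = algebraMap K (AlgebraicClosure K) (γ a))
  (A₀ : AbelianVariety K) (ℓ : ℕ) [Fact ℓ.Prime]

/-! ## §1 The transport on the rational Tate module `V_ℓ A₀ ≃ₗ[ℚ_ℓ] V_ℓ A₀^γ` -/

/-- **`V_ℓ` of the `σ̃`-transport: `V_ℓ A₀ ≃ₗ[ℚ_ℓ] V_ℓ A₀^γ`**, the base change `ℚ_ℓ ⊗_{ℤ_ℓ} E` of ★ `conjTransportTateEquiv`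
(`(a_n)_n ↦ (a_n^σ̃)_n`). [cite: Shimura1998, §18.6 proof of Thm. 18.6, p. 129] [cite: SerreTate1968, §1] -/
def conjTransportRatTateEquiv : A₀.rationalTateModule ℓ ≃ₗ[ℚ_[ℓ]] (A₀.conjugate γ).rationalTateModule ℓ :=
  (conjTransportTateEquiv γ σt hσa A₀ ℓ).baseChange ℤ_[ℓ] ℚ_[ℓ] (A₀.tateModule ℓ) ((A₀.conjugate γ).tateModule ℓ)

/-- As a linear map, `Eℚ = ℚ_ℓ ⊗ E` (`rfl`). [cite: SerreTate1968, §1] -/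
theorem coe_conjTransportRatTateEquiv :
    (conjTransportRatTateEquiv γ σt hσa A₀ ℓ : A₀.rationalTateModule ℓ →ₗ[ℚ_[ℓ]] (A₀.conjugate γ).rationalTateModule ℓ) =
      (conjTransportTateEquiv γ σt hσa A₀ ℓ).toLinearMap.baseChange ℚ_[ℓ] :=
  rfl

variable {γ σt A₀ ℓ}

/-- The `ℤ_ℓ`-level twisted equivariance in `Representation` form: `E ∘ ρ_{A₀}(σ̃⁻¹τσ̃) = ρ_{A₀^γ}(τ) ∘ E`
(★ `conjTransportTateEquiv_smul_of_semiconj` at `ρ := σ̃⁻¹τσ̃`, whose semiconjugation `σ̃ (ρ • y) = τ • σ̃ y` is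
★ `apply_absGalConjBy_smul`). [cite: Shimura1998, §18.6 proof of Thm. 18.6, p. 129] -/
theorem conjTransportTateEquiv_comp_tateRep (τ : Field.absoluteGaloisGroup K) :
    (conjTransportTateEquiv γ σt hσa A₀ ℓ).toLinearMap ∘ₗ A₀.tateRep ℓ (absGalConjBy σt γ hσa τ) =
      (A₀.conjugate γ).tateRep ℓ τ ∘ₗ (conjTransportTateEquiv γ σt hσa A₀ ℓ).toLinearMap := by
  apply LinearMap.ext
  intro a
  simp only [LinearMap.coe_comp, Function.comp_apply, LinearEquiv.coe_coe, tateRep_apply_apply]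
  exact conjTransportTateEquiv_smul_of_semiconj hσa (absGalConjBy σt γ hσa τ) τ
    (fun y => apply_absGalConjBy_smul σt γ hσa τ y) a

/-- **Twisted equivariance on `V_ℓ`: `Eℚ (ρ_{A₀}(σ̃⁻¹τσ̃) v) = ρ_{A₀^γ}(τ) (Eℚ v)`** (base change of the `ℤ_ℓ`-level
identity; `rationalTateRep = (tateRep).baseChange` by `rfl`). [cite: Shimura1998, §18.6 proof of Thm. 18.6, p. 129] [cite: SerreTate1968, §1] -/
theorem conjTransportRatTateEquiv_rationalTateRep (τ : Field.absoluteGaloisGroup K) (v : A₀.rationalTateModule ℓ) :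
    conjTransportRatTateEquiv γ σt hσa A₀ ℓ (A₀.rationalTateRep ℓ (absGalConjBy σt γ hσa τ) v) =
      (A₀.conjugate γ).rationalTateRep ℓ τ (conjTransportRatTateEquiv γ σt hσa A₀ ℓ v) := by
  have key : ((conjTransportTateEquiv γ σt hσa A₀ ℓ).toLinearMap.baseChange ℚ_[ℓ]).comp
        ((A₀.tateRep ℓ (absGalConjBy σt γ hσa τ)).baseChange ℚ_[ℓ]) =
      (((A₀.conjugate γ).tateRep ℓ τ).baseChange ℚ_[ℓ]).comp
        ((conjTransportTateEquiv γ σt hσa A₀ ℓ).toLinearMap.baseChange ℚ_[ℓ]) := by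
    rw [← LinearMap.baseChange_comp, ← LinearMap.baseChange_comp, conjTransportTateEquiv_comp_tateRep]
  exact LinearMap.congr_fun key v

/-- **Naturality on `V_ℓ`: `Eℚ_B (V_ℓ(f) v) = V_ℓ(f^γ) (Eℚ_A v)`** for `f : A₀ → B₀` (base change of
★ `conjTransportTateEquiv_tateModuleMap'`). [cite: Shimura1998, §18.6 proof of Thm. 18.6, p. 129 (λ ↦ λ^σ)] -/
theorem conjTransportRatTateEquiv_rationalTateModuleMap {B₀ : AbelianVariety K} (f : A₀ ⟶ B₀)
    (v : A₀.rationalTateModule ℓ) :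
    conjTransportRatTateEquiv γ σt hσa B₀ ℓ (rationalTateModuleMap ℓ f v) =
      rationalTateModuleMap ℓ (Hom.conjugate γ f) (conjTransportRatTateEquiv γ σt hσa A₀ ℓ v) := by
  have hT : (conjTransportTateEquiv γ σt hσa B₀ ℓ).toLinearMap ∘ₗ tateModuleMap ℓ f =
      tateModuleMap ℓ (Hom.conjugate γ f) ∘ₗ (conjTransportTateEquiv γ σt hσa A₀ ℓ).toLinearMap := by
    apply LinearMap.ext
    intro a
    simp only [LinearMap.coe_comp, Function.comp_apply, LinearEquiv.coe_coe]
    exact conjTransportTateEquiv_tateModuleMap' hσa f a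
  have key : ((conjTransportTateEquiv γ σt hσa B₀ ℓ).toLinearMap.baseChange ℚ_[ℓ]).comp
        ((tateModuleMap ℓ f).baseChange ℚ_[ℓ]) =
      ((tateModuleMap ℓ (Hom.conjugate γ f)).baseChange ℚ_[ℓ]).comp
        ((conjTransportTateEquiv γ σt hσa A₀ ℓ).toLinearMap.baseChange ℚ_[ℓ]) := by
    rw [← LinearMap.baseChange_comp, ← LinearMap.baseChange_comp, hT]
  exact LinearMap.congr_fun key v

/-! ## §2 The transport on `H¹_ét = Hom(V_ℓ, ℚ_ℓ)`: contragredient equivariance -/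

variable (γ σt A₀ ℓ) in
/-- **`H¹_ét` of the `σ̃`-transport: `H¹_ét(A₀^γ ⊗ K̄, ℚ_ℓ) ≃ₗ[ℚ_ℓ] H¹_ét(A₀ ⊗ K̄, ℚ_ℓ)`**, i.e.
`Hom(V_ℓ A₀^γ, ℚ_ℓ) ≃ Hom(V_ℓ A₀, ℚ_ℓ)`, `φ ↦ φ ∘ Eℚ` (the dual of `Eℚ`; Milne Thm. 15.1 (a) for the identification of
`H¹_ét` with the dual Tate module). [cite: Milne1986AbelianVarieties, Thm 15.1 (a)] [cite: Shimura1998, §18.6 proof of Thm. 18.6, p. 129] -/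
def conjTransportEtaleH1Equiv :
    Module.Dual ℚ_[ℓ] ((A₀.conjugate γ).rationalTateModule ℓ) ≃ₗ[ℚ_[ℓ]] Module.Dual ℚ_[ℓ] (A₀.rationalTateModule ℓ) :=
  (conjTransportRatTateEquiv γ σt hσa A₀ ℓ).dualMap

/-- Unfolding: `ψ φ = φ ∘ Eℚ`. [cite: Milne1986AbelianVarieties, Thm 15.1 (a)] -/
theorem conjTransportEtaleH1Equiv_apply (φ : Module.Dual ℚ_[ℓ] ((A₀.conjugate γ).rationalTateModule ℓ))
    (v : A₀.rationalTateModule ℓ) :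
    conjTransportEtaleH1Equiv γ σt hσa A₀ ℓ φ v = φ (conjTransportRatTateEquiv γ σt hσa A₀ ℓ v) :=
  rfl

/-- **Contragredient twisted equivariance on `H¹_ét`**: for the dual representations `ρ^∨(g) φ = φ ∘ ρ(g⁻¹)` (Mathlib
`Representation.dual`), `ψ (ρ^∨_{A₀^γ}(τ) φ) = ρ^∨_{A₀}(σ̃⁻¹τσ̃) (ψ φ)` — the action of `τ` on `H¹_ét(A₀^γ)` is read on
`H¹_ét(A₀)` as the action of `σ̃⁻¹τσ̃` (e.g. an arithmetic Frobenius at `𝔓` as one at `σ̃⁻¹𝔓`).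
[cite: Shimura1998, §18.6 proof of Thm. 18.6, p. 129] [cite: Deligne1982, §1] -/
theorem conjTransportEtaleH1Equiv_dual (τ : Field.absoluteGaloisGroup K)
    (φ : Module.Dual ℚ_[ℓ] ((A₀.conjugate γ).rationalTateModule ℓ)) :
    conjTransportEtaleH1Equiv γ σt hσa A₀ ℓ (((A₀.conjugate γ).rationalTateRep ℓ).dual τ φ) =
      (A₀.rationalTateRep ℓ).dual (absGalConjBy σt γ hσa τ) (conjTransportEtaleH1Equiv γ σt hσa A₀ ℓ φ) := by
  apply LinearMap.ext
  intro v
  simp only [conjTransportEtaleH1Equiv_apply, Representation.dual_apply, Module.Dual.transpose_apply,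
    LinearMap.coe_comp, Function.comp_apply]
  rw [← map_inv, conjTransportRatTateEquiv_rationalTateRep]

/-- **Naturality on `H¹_ét`: `ψ_A ((V_ℓ f^γ)^∨ φ) = (V_ℓ f)^∨ (ψ_B φ)`** for `f : A₀ → B₀` (`(·)^∨ = LinearMap.dualMap`).
[cite: Shimura1998, §18.6 proof of Thm. 18.6, p. 129 (λ ↦ λ^σ)] -/
theorem conjTransportEtaleH1Equiv_dualMap {B₀ : AbelianVariety K} (f : A₀ ⟶ B₀)
    (φ : Module.Dual ℚ_[ℓ] ((B₀.conjugate γ).rationalTateModule ℓ)) :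
    conjTransportEtaleH1Equiv γ σt hσa A₀ ℓ ((rationalTateModuleMap ℓ (Hom.conjugate γ f)).dualMap φ) =
      (rationalTateModuleMap ℓ f).dualMap (conjTransportEtaleH1Equiv γ σt hσa B₀ ℓ φ) := by
  apply LinearMap.ext
  intro v
  simp only [conjTransportEtaleH1Equiv_apply, LinearMap.dualMap_apply]
  rw [conjTransportRatTateEquiv_rationalTateModuleMap]

end RatTate

end AbelianVariety

end Literature.AlgebraicGeometry.Motives

end
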